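import Mathlib
import HarnessLib
import Literature.Analysis.FluidPDE.VectorCalculus
import Literature.Analysis.FluidPDE.VorticityCalculus
import Summits.NavierStokesRegularity.NavierStokesRegularity.Theorems.UnthreadedDoorAntidynamoEvenRungCentre
import Summits.NavierStokesRegularity.NavierStokesRegularity.Theorems.UnthreadedDoorAntidynamoReflectionParity
import Summits.NavierStokesRegularity.NavierStokesRegularity.Theorems.UnthreadedDoorAntidynamoSingleDegreeRungGradientBranch
import Summits.NavierStokesRegularity.NavierStokesRegularity.Theorems.UnthreadedDoorAntidynamoTranslationRigidity
import Summits.NavierStokesRegularity.NavierStokesRegularity.Theorems.UnthreadedDoorAntidynamoVorticityStructure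
import Summits.NavierStokesRegularity.NavierStokesRegularity.Theorems.UnthreadedDoorVorticityOfClass

/-!
# Route `UnthreadedDoor` / `ThreadingFlux`, crux `PoloidalLiouville` (stmt-NavierStokesRegularity-1222), antidynamo v2 skeleton,
# rung `stub_singleDegreeRung`, EVEN degree — ★★ THE STAGNATION ALTERNATIVE: at every slice the centre is a stagnation point or the
# slice is constant

Support file (census instrument decomp-ns-census-1 g33, cell decomp-ns; `--supports stmt-NavierStokesRegularity-1222 --as helper`; 0 kit).

State of the even rung before this file (tree, by name): odd degree PROVED (`singleDegreeRung_odd`, p798877); zonal profiles of every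
degree PROVED (`singleDegreeRung_zonal`, p811987); for even degree the parity reduction `singleDegreeRung_even_parity` (p798954) gives,
at every slice, `v t (2x₀ − y) = 2 v t x₀ − v t y` and the ONE identity `D(curl (v t))(x)[v t x₀] = 0` (the vorticity is invariant
under translation by the centre velocity `b := v t x₀`), and the remaining piece is the (E1) assembly feeding
`singleDegreeRung_of_sliceData` (p811987).

THIS FILE turns the parity identity into a theorem stratum of the rung, via the pure translation-rigidity lemma
`vortAmp_eq_zero_of_fderiv_apply_eq_zero` (`…AntidynamoTranslationRigidity`, same seat: a bounded differentiable single-degree field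
`G(‖y‖) • Λ(y)` with `Λ` tangent, positively homogeneous and non-trivial, invariant under a non-zero translation, has `G ≡ 0` — by the ray
identity, Euler's ODE and boundedness at BOTH ends of the ray; no harmonicity, no algebra of the profile) applied to `w = curl (v t)`
(smooth, bounded by `exists_norm_curl_le`), `Λ = ∇P × id` (tangent: `⟪y, ∇P(y) × y⟫ = 0`), `G = ĝ` (analytic, p811643) and `b = v t x₀`:

* ★★ `evenRung_slice_const_of_centre_velocity_ne_zero` — under the rung's VERBATIM hypotheses with even `l` and `P ≠ 0`, a slice with
  `v t x₀ ≠ 0` is constant (`ĝ ≡ 0` and the centre package's closure of that branch);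
* ★★ `evenRung_stagnation_alternative` — at every slice, `v t x₀ = 0 ∨ ∃ b, ∀ x, v t x = b` (for `P = 0` the gradient branch);
* ★ `evenRung_odd_of_not_const` — a NON-constant slice has a stagnation point at the centre and is ODD about it:
  `v t x₀ = 0 ∧ ∀ y, v t (x₀ + x₀ − y) = −v t y`.

MEANING for the (E1) hand: WLOG the centre is a STAGNATION POINT of every non-constant slice and the slice is odd about `x₀`; the
translation part of the harmonic remainder of the kinematic normal form is dead by theorem (not merely harmless by parity).  The even rung
for non-zonal profiles remains open (the (E1) assembly proper); the WALL `stub_scalarLiouville` is untouched.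

HONEST LABEL: composition of tree theorems (p798954 parity, p811643 centre package, p797227 S2, `exists_norm_curl_le`) with one pure
rigidity lemma, serving the open EVEN-degree rung of an S-free Liouville engine; the rung, the wall, `PoloidalLiouville` (1222) and
Navier–Stokes regularity are NOT touched (crux 1222 is INCOMPARABLE with the summit; descent inside the door's cone, decorative for the
summit).  Nothing here proves NavierStokesRegularity. [folklore]
-/

noncomputable section

-- the summit and its single sub-problem share the name (CONVENTIONS §1), as in every Theorems file
set_option linter.dupNamespace false

open scoped Topology InnerProductSpace RealInnerProductSpace ContDiff
open Filter Set Metric MeasureTheory MvPolynomial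
open Literature.Analysis.FluidPDE

namespace Summit.NavierStokesRegularity.NavierStokesRegularity.Theorems.PoloidalLiouville.Antidynamo

/-! ### ★★ The even rung: the stagnation alternative -/

/-- ★★ **A SLICE WHOSE CENTRE MOVES IS CONSTANT.**  Under the rung's verbatim hypotheses with EVEN `l` and `P ≠ 0`, at a slice `t < 0`
with `v t x₀ ≠ 0` the slice is constant: the parity identity `D(curl (v t))(x)[v t x₀] = 0` (p798954) and translation rigidity give
`ĝ ≡ 0`, and the centre package (p811643) concludes. [folklore] -/
theorem evenRung_slice_const_of_centre_velocity_ne_zero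
    (v : ℝ → EuclideanSpace ℝ (Fin 3) → EuclideanSpace ℝ (Fin 3)) (x₀ : EuclideanSpace ℝ (Fin 3))
    (hB : Literature.Analysis.FluidPDE.IsBoundedAncientMildSolution 1 v)
    (hm : ∀ t < 0, AEStronglyMeasurable (v t) volume)
    (hsm : ContDiffOn ℝ (⊤ : ℕ∞) (Function.uncurry v) (Set.Iio 0 ×ˢ Set.univ))
    {l : ℕ} {P : MvPolynomial (Fin 3) ℝ} (hl : 2 ≤ l) (hev : Even l) (hP : P.IsHomogeneous l) (hP0 : P ≠ 0)
    (hharm : ∀ y : EuclideanSpace ℝ (Fin 3),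
      Laplacian.laplacian (fun z : EuclideanSpace ℝ (Fin 3) => MvPolynomial.eval (fun i => z i) P) y = 0)
    (hrep : ∀ t < 0, ∃ (g : ℝ → ℝ) (φ : EuclideanSpace ℝ (Fin 3) → ℝ), ∀ x,
      v t x = gradient φ x + (g ‖x - x₀‖ * MvPolynomial.eval (fun i => (x - x₀) i) P) • (x - x₀))
    {t : ℝ} (ht : t < 0) (hne : v t x₀ ≠ 0) :
    ∃ b : EuclideanSpace ℝ (Fin 3), ∀ x, v t x = b := by
  obtain ⟨ĝ, hĝan, hcurl, -, hconst⟩ := singleDegree_vorticity_structure_centre v x₀ hB hm hsm hl hP hP0 hharm hrep t ht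
  obtain ⟨-, hpar⟩ := singleDegreeRung_even_parity v x₀ hB hm hsm hl hev hP hP0 hharm hrep t ht
  -- the profile
  set Q : EuclideanSpace ℝ (Fin 3) → ℝ := fun z => MvPolynomial.eval (fun i => z i) P with hQ
  have hQω : ContDiff ℝ ω Q := contDiff_omega_evalPoly P
  have hQhom : ∀ r : ℝ, 0 < r → ∀ y : EuclideanSpace ℝ (Fin 3), Q (r • y) = r ^ l * Q y :=
    fun r _ y => evalPoly_smul hP r y
  have hl1 : 1 ≤ l := by omega
  have hQne : ∃ y, Q y ≠ 0 := exists_evalPoly_ne_zero hP0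
  obtain ⟨ξ, hξ1, hξ⟩ := exists_unit_cross_gradient_ne_zero hQω hl1 hQhom hharm hQne
  have hΛd : Differentiable ℝ fun y : EuclideanSpace ℝ (Fin 3) => cross (gradient Q y) y :=
    (contDiff_omega_cross_gradient hQω).differentiable (by simp)
  have hΛhom : ∀ r : ℝ, 0 < r → ∀ y : EuclideanSpace ℝ (Fin 3),
      cross (gradient Q (r • y)) (r • y) = r ^ l • cross (gradient Q y) y :=
    fun r hr y => cross_gradient_smul_of_homogeneous (hQω.differentiable (by simp)) hQhom hr y
  have htan : ∀ y : EuclideanSpace ℝ (Fin 3), ⟪y, cross (gradient Q y) y⟫ = 0 := by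
    intro y
    simp only [cross, PiLp.inner_apply, cross_apply, RCLike.inner_apply, conj_trivial, Fin.sum_univ_three,
      Matrix.cons_val_zero, Matrix.cons_val_one, Matrix.cons_val_two, Matrix.head_cons, Matrix.tail_cons]
    ring
  -- the slice: `w := curl (v t)` is smooth and bounded
  have hsm' : IsSmoothSpaceTimeOn (Iio 0) v := hsm
  have hvt : ContDiff ℝ ∞ (v t) := hsm'.contDiff_slice ht
  have hwd : Differentiable ℝ (curl (v t)) := by
    have hω : ContDiff ℝ ∞ (curl (v t)) := by
      rw [curl_eq_curlCLM_comp]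
      exact curlCLM.contDiff.comp (hvt.fderiv_right (m := ∞) (by simp))
    exact hω.differentiable (by simp)
  obtain ⟨K, hK⟩ := PoloidalLiouville.exists_norm_curl_le hB hsm
  have hG : ∀ r, 0 < r → DifferentiableAt ℝ ĝ r := fun r hr => (hĝan r hr).differentiableAt
  exact hconst (vortAmp_eq_zero_of_fderiv_apply_eq_zero (Λ := fun y => cross (gradient Q y) y) hΛd hl1 hΛhom htan hξ1 hξ
    hwd (fun x => hK t ht x) hG hcurl hne fun x _ => hpar x)

/-- ★★ **THE STAGNATION ALTERNATIVE OF THE EVEN RUNG.**  Under the rung's verbatim hypotheses with EVEN `l` (the profile `P` may vanish: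
then every slice is a gradient and constant, p798703's branch), at every slice `t < 0` EITHER the centre is a stagnation point,
`v t x₀ = 0`, OR the slice is constant. [folklore] -/
theorem evenRung_stagnation_alternative
    (v : ℝ → EuclideanSpace ℝ (Fin 3) → EuclideanSpace ℝ (Fin 3)) (x₀ : EuclideanSpace ℝ (Fin 3))
    (hB : Literature.Analysis.FluidPDE.IsBoundedAncientMildSolution 1 v)
    (hm : ∀ t < 0, AEStronglyMeasurable (v t) volume)
    (hsm : ContDiffOn ℝ (⊤ : ℕ∞) (Function.uncurry v) (Set.Iio 0 ×ˢ Set.univ))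
    {l : ℕ} {P : MvPolynomial (Fin 3) ℝ} (hl : 2 ≤ l) (hev : Even l) (hP : P.IsHomogeneous l)
    (hharm : ∀ y : EuclideanSpace ℝ (Fin 3),
      Laplacian.laplacian (fun z : EuclideanSpace ℝ (Fin 3) => MvPolynomial.eval (fun i => z i) P) y = 0)
    (hrep : ∀ t < 0, ∃ (g : ℝ → ℝ) (φ : EuclideanSpace ℝ (Fin 3) → ℝ), ∀ x,
      v t x = gradient φ x + (g ‖x - x₀‖ * MvPolynomial.eval (fun i => (x - x₀) i) P) • (x - x₀)) :
    ∀ t < 0, v t x₀ = 0 ∨ ∃ b : EuclideanSpace ℝ (Fin 3), ∀ x, v t x = b := by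
  intro t ht
  by_cases hP0 : P = 0
  · right
    refine constant_of_forall_gradient_slices v hB hsm (fun s hs => ?_) t ht
    obtain ⟨g, φ, hv⟩ := hrep s hs
    exact ⟨φ, fun x => by rw [hv x, hP0, map_zero, mul_zero, zero_smul, add_zero]⟩
  · by_cases hne : v t x₀ = 0
    · exact Or.inl hne
    · exact Or.inr (evenRung_slice_const_of_centre_velocity_ne_zero v x₀ hB hm hsm hl hev hP hP0 hharm hrep ht hne)

/-- ★ **NORMAL FORM OF A NON-CONSTANT SLICE OF THE EVEN RUNG** (`P ≠ 0`): the centre is a stagnation point and the slice is ODD about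
it, `v t (x₀ + x₀ − y) = −v t y` (the parity identity of p798954 with `v t x₀ = 0`). [folklore] -/
theorem evenRung_odd_of_not_const
    (v : ℝ → EuclideanSpace ℝ (Fin 3) → EuclideanSpace ℝ (Fin 3)) (x₀ : EuclideanSpace ℝ (Fin 3))
    (hB : Literature.Analysis.FluidPDE.IsBoundedAncientMildSolution 1 v)
    (hm : ∀ t < 0, AEStronglyMeasurable (v t) volume)
    (hsm : ContDiffOn ℝ (⊤ : ℕ∞) (Function.uncurry v) (Set.Iio 0 ×ˢ Set.univ))
    {l : ℕ} {P : MvPolynomial (Fin 3) ℝ} (hl : 2 ≤ l) (hev : Even l) (hP : P.IsHomogeneous l) (hP0 : P ≠ 0)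
    (hharm : ∀ y : EuclideanSpace ℝ (Fin 3),
      Laplacian.laplacian (fun z : EuclideanSpace ℝ (Fin 3) => MvPolynomial.eval (fun i => z i) P) y = 0)
    (hrep : ∀ t < 0, ∃ (g : ℝ → ℝ) (φ : EuclideanSpace ℝ (Fin 3) → ℝ), ∀ x,
      v t x = gradient φ x + (g ‖x - x₀‖ * MvPolynomial.eval (fun i => (x - x₀) i) P) • (x - x₀))
    {t : ℝ} (ht : t < 0) (hnc : ¬ ∃ b : EuclideanSpace ℝ (Fin 3), ∀ x, v t x = b) :
    v t x₀ = 0 ∧ ∀ y, v t (x₀ + x₀ - y) = -v t y := by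
  have h0 : v t x₀ = 0 := by
    by_contra hne
    exact hnc (evenRung_slice_const_of_centre_velocity_ne_zero v x₀ hB hm hsm hl hev hP hP0 hharm hrep ht hne)
  obtain ⟨hrefl, -⟩ := singleDegreeRung_even_parity v x₀ hB hm hsm hl hev hP hP0 hharm hrep t ht
  exact ⟨h0, fun y => by rw [hrefl y, h0, add_zero, zero_sub]⟩

end Summit.NavierStokesRegularity.NavierStokesRegularity.Theorems.PoloidalLiouville.Antidynamo

end
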